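import Summits.ABC.ABC.Theorems.CuspFieldPencilGoldenFromNFPencil
import Literature.NumberTheory.DiophantineGeometry.MatveevYuPlaceBoundsNumberField
import Literature.NumberTheory.DiophantineGeometry.AbcTwoAdicValuationProofs
import Literature.NumberTheory.DiophantineGeometry.PastenSubexpDecomposition
import Literature.NumberTheory.EllipticCurves.HeightsBaseChangeProofs
import Literature.IUT.LogVolume.ArakelovDivisors
import HarnessLib

/-!
# STUB-IDEAS `stub_conjugateCuspTriple` — ideator k=2, GEN 7 (FAMILY 2: RESHAPE) — Sketch

Crux `GoldenCuspShadow` (stmt-ABC-26026), route `CuspFieldPencil`. `Q = u² − 11uw − w²`,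
`R = rad(uwQ)`, `H = max(|u|,|w|)`, `m = min(rad u, rad w)`, `q = rad Q`.

GEN-7 RESHAPE (symmetrise the place cost).  g6 (`SideaK2G6`) bootstrapped the K-datum
`q² ↦ q` through F1 `splitPlace`, a decomposition-law lemma that needs the integral basis
`𝓞_K = ℤ + ℤθ` — NOT in the tree (`GoldenFieldClassNumberOne` gets the PID by Minkowski only).
Here the fine cost is obtained from the GALOIS INVOLUTION `σ = star` of `K = QuadraticAlgebra ℚ 1 1`
(Mathlib `starRingAut`, restricted by `RingOfIntegers.mapRingEquiv`): for `p ∣ Q`, `p ≠ 5`, EVERY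
prime `𝔭 ∋ p` of `𝓞_K` has `N𝔭 = p` — if `N𝔭 = p²` then `𝔭 = (p) = σ𝔭`, `𝔭 ∋ x₊x₋ = Q` gives
`𝔭 ∋ x₊` and (apply `σ`) `𝔭 ∋ x₋`, so `𝔭 ∋ 5√5` (tree `sqrtFive_mem_sup`) and `𝔭 ∋ (5√5)² = 125`,
`𝔭 ∋ p`, `gcd(p,125) = 1 ∈ 𝔭`: absurd.  Ideal-level only; no `ℤ[θ]`-coordinates, no Kummer–Dedekind.
With this DEGREE-ONE COST in place of g5's crude `place_cost` (`N𝔭 ≤ p²`), g5-H8/H11 run with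
`rad(F)¹` and give `QSideRad` DIRECTLY (the `q²` stage `QSideRadSq` and its 2/5 payoff are skipped):
`UWHalf ∧ QSideRad ⇒ stub` (P1 below) and `⇒ GoldenThird` (g6 `third_of_uwHalf_qSideRad`, PROVED).

Kernel status: N1, N2, N3, N4, N5 (the whole new symmetry block), G, G' (golden instantiation),
P1 (payoff) and the composition are PROVED (sorry-free): everything golden-specific is closed.
`sorry` exactly in the THREE open generic helpers: g5-H5 `fNotSmall` (arch half, abstract `K`, ported
verbatim), H8f `fUpper_fine` (finite half with the degree-one cost, abstract `K`), H11r
`normFormSide_one_of_bounds` (`K`-free real endgame); H11f `normFormSide_one` is their PROVED composition.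
-/

set_option linter.dupNamespace false

noncomputable section

open Real NumberField UniqueFactorizationMonoid Height IsDedekindDomain Finset QuadraticAlgebra
open Literature.NumberTheory.DiophantineGeometry
open Literature.NumberTheory.DiophantineGeometry.Dioph
open Literature.IUT.LogVolume

namespace Summit.ABC.ABC.Cruxes.GoldenCuspShadow.SideaK2G7

/-! ## §0 Statements (verbatim from g5/g6 so that names align) -/

/-- The registered stub `stub_conjugateCuspTriple`, verbatim. -/
def StubConjugate : Prop :=
  ∀ ε : ℝ, 0 < ε → ∃ κ : ℝ, ∀ u w : ℤ, IsCoprime u w → u * w * (u ^ 2 - 11 * u * w - w ^ 2) ≠ 0 →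
    Real.log (max (|(u : ℝ)|) (|(w : ℝ)|)) ≤
      κ * (((UniqueFactorizationMonoid.radical (u * w * (u ^ 2 - 11 * u * w - w ^ 2))).natAbs : ℕ) : ℝ) ^ (ε : ℝ) *
        ((((UniqueFactorizationMonoid.radical (u ^ 2 - 11 * u * w - w ^ 2)).natAbs : ℕ) : ℝ) ^ (2 / 3 : ℝ) *
          (min (((UniqueFactorizationMonoid.radical u).natAbs : ℕ) : ℝ)
              (((UniqueFactorizationMonoid.radical w).natAbs : ℕ) : ℝ)) ^ (2 / 3 : ℝ))

/-- ℚ-engine output (KERNEL-CLOSED in the crux dir, `GoldenCuspShadowBaker.cuspMinRadBound_holds`). -/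
def UWHalf : Prop :=
  ∀ δ : ℝ, 0 < δ → ∃ κ : ℝ, ∀ u w : ℤ, IsCoprime u w → u * w * (u ^ 2 - 11 * u * w - w ^ 2) ≠ 0 →
    Real.log (max (|(u : ℝ)|) (|(w : ℝ)|)) ≤
      κ * (((radical (u * w * (u ^ 2 - 11 * u * w - w ^ 2))).natAbs : ℕ) : ℝ) ^ (δ : ℝ) *
        min (((radical u).natAbs : ℕ) : ℝ) (((radical w).natAbs : ℕ) : ℝ)

/-- FINE K-datum (this generation's direct target): `log H ≤ κ_δ R^δ · rad(Q)`. -/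
def QSideRad : Prop :=
  ∀ δ : ℝ, 0 < δ → ∃ κ : ℝ, ∀ u w : ℤ, IsCoprime u w → u * w * (u ^ 2 - 11 * u * w - w ^ 2) ≠ 0 →
    Real.log (max (|(u : ℝ)|) (|(w : ℝ)|)) ≤
      κ * (((radical (u * w * (u ^ 2 - 11 * u * w - w ^ 2))).natAbs : ℕ) : ℝ) ^ (δ : ℝ) *
        (((radical (u ^ 2 - 11 * u * w - w ^ 2)).natAbs : ℕ) : ℝ)

/-- Route payoff of the fine road: exponent `1/3`. -/
def GoldenThird : Prop :=
  ∀ ε : ℝ, 0 < ε → ∃ κ : ℝ, ∀ u w : ℤ, IsCoprime u w → u * w * (u ^ 2 - 11 * u * w - w ^ 2) ≠ 0 →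
    Real.log (max (|(u : ℝ)|) (|(w : ℝ)|)) ≤
      κ * (((radical (u * w * (u ^ 2 - 11 * u * w - w ^ 2))).natAbs : ℕ) : ℝ) ^ (1 / 3 + ε : ℝ)

/-- g5's shape hypothesis (PROVED there from Matveev-NF ∧ Yu-NF: `SideaK2G5.nfPlaceBound_of_matveev_yu`). -/
def NFPlaceBound (K : Type) [Field K] [NumberField K] : Prop :=
  ∃ c : ℝ, 1 ≤ c ∧ ∀ (κ : Type) [Fintype κ], 2 ≤ Fintype.card κ →
    ∀ (α : κ → K) (b : κ → ℤ) (B : ℝ),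
      (∀ k, α k ≠ 0) → ∏ k, α k ^ b k - 1 ≠ 0 → 3 ≤ B → (∀ k, (|b k| : ℝ) ≤ B) →
      (∀ w : InfinitePlace K,
          -(c ^ Fintype.card κ * (∏ k, max (logHeight₁ (α k)) 1) * Real.log B) <
            (w.mult : ℝ) * Real.log (w (∏ k, α k ^ b k - 1))) ∧
      (∀ 𝔭 : HeightOneSpectrum (𝓞 K),
          -(c ^ Fintype.card κ *
              ((Ideal.absNorm 𝔭.asIdeal : ℝ) / Real.log (Ideal.absNorm 𝔭.asIdeal : ℝ)) *
              (∏ k, max (logHeight₁ (α k)) 1) * Real.log B) <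
            Real.log (NumberField.HeightOneSpectrum.adicAbv K 𝔭 (∏ k, α k ^ b k - 1)))

/-- g5's member error term `T(u,v) = A·C^{ω(uv)}·(∏_{p∣uv} log p)·log(2 log H₀ + 3)`. -/
def memberT (A C : ℝ) (u v : ℤ) : ℝ :=
  A * C ^ (u * v).natAbs.primeFactors.card * (∏ p ∈ (u * v).natAbs.primeFactors, Real.log p) *
    Real.log (2 * Real.log (max (|(u : ℝ)|) (|(v : ℝ)|)) + 3)

/-- g5: the binary norm form of `β`, `β² = sβ − n`: `F(u,w) = u² − s·uw + n·w²` (golden: `s=11,n=−1`). -/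
def normForm (s n u w : ℤ) : ℤ := u ^ 2 - s * u * w + n * w ^ 2

/-- g5: `log H ≤ κ_δ rad(uwF)^δ · rad(F)^d` (this generation wants `d = 1`). -/
def NormFormSide (d : ℕ) (s n : ℤ) : Prop :=
  ∀ δ : ℝ, 0 < δ → ∃ κ : ℝ, ∀ u w : ℤ, IsCoprime u w → u * w * normForm s n u w ≠ 0 →
    Real.log (max (|(u : ℝ)|) (|(w : ℝ)|)) ≤
      κ * (((radical (u * w * normForm s n u w)).natAbs : ℕ) : ℝ) ^ (δ : ℝ) *
        (((radical (normForm s n u w)).natAbs : ℕ) : ℝ) ^ d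

/-- NEW hypothesis-shape: **degree-one cost** for the norm form of `β` away from `N₀`:
every prime of `𝓞_K` above a rational prime `p ∤ N₀` dividing a primitive value `F(u,w)` has norm `p`. -/
def DegOneCost (K : Type) [Field K] [NumberField K] (s n : ℤ) (N₀ : ℕ) : Prop :=
  ∀ p : ℕ, p.Prime → ¬ p ∣ N₀ → ∀ u w : ℤ, IsCoprime u w → (p : ℤ) ∣ normForm s n u w →
    normForm s n u w ≠ 0 → ∀ 𝔭 : HeightOneSpectrum (𝓞 K), ((p : ℕ) : 𝓞 K) ∈ 𝔭.asIdeal →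
      Ideal.absNorm 𝔭.asIdeal = p

/-! ## §1 NEW — the Galois involution replaces the decomposition law (N1–N5) -/

section Golden

variable [Fact (∀ r : ℚ, r ^ 2 ≠ (1 : ℚ) + 1 * r)]

/-- **N1 (XS, PROVED).** `σ = star` moves `θ = ω` to its conjugate `1 − θ` (`star ⟨0,1⟩ = ⟨1,−1⟩`). -/
theorem sigma_theta :
    NumberField.RingOfIntegers.mapRingEquiv
        (starRingAut : QuadraticAlgebra ℚ 1 1 ≃+* QuadraticAlgebra ℚ 1 1)
        ⟨ω, Summit.ABC.ABC.Theorems.GoldenField.isIntegral_omega⟩ =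
      1 - ⟨ω, Summit.ABC.ABC.Theorems.GoldenField.isIntegral_omega⟩ := by
  apply RingOfIntegers.coe_injective
  simp only [map_sub, map_one]
  rw [show algebraMap (𝓞 (QuadraticAlgebra ℚ 1 1)) (QuadraticAlgebra ℚ 1 1)
      (RingOfIntegers.mapRingEquiv (starRingAut : QuadraticAlgebra ℚ 1 1 ≃+* QuadraticAlgebra ℚ 1 1)
        ⟨ω, Summit.ABC.ABC.Theorems.GoldenField.isIntegral_omega⟩) =
      starRingAut (ω : QuadraticAlgebra ℚ 1 1) from rfl]
  rw [RingOfIntegers.map_mk]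
  ext <;> simp [starRingAut, omega]

end Golden

/-- **N2 (XS, PROVED; any field `K` with an automorphism moving `θ ↦ 1 − θ`).** `σ` swaps the two conjugate
cusp forms: `σ(u + β₂w) = u + β₃w`, `σ(u + β₃w) = u + β₂w` (`β₂ = −3−5θ`, `β₃ = −8+5θ`). -/
theorem sigma_forms (K : Type) [Field K] (σ : K ≃+* K) (θ : 𝓞 K)
    (hσ : NumberField.RingOfIntegers.mapRingEquiv σ θ = 1 - θ) (u w : ℤ) :
    NumberField.RingOfIntegers.mapRingEquiv σ ((u : 𝓞 K) + (-3 - 5 * θ) * w) =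
        (u : 𝓞 K) + (-8 + 5 * θ) * w ∧
      NumberField.RingOfIntegers.mapRingEquiv σ ((u : 𝓞 K) + (-8 + 5 * θ) * w) =
        (u : 𝓞 K) + (-3 - 5 * θ) * w := by
  constructor <;> · simp only [map_add, map_sub, map_mul, map_neg, map_intCast, map_ofNat, hσ]; ring

/-- R0 (g5, PROVED there; ported): `N((p)) = p^{[K:ℚ]}`. [folklore] -/
theorem absNorm_span_natCast (K : Type) [Field K] [NumberField K] (p : ℕ) :
    Ideal.absNorm (Ideal.span {((p : ℕ) : 𝓞 K)}) = p ^ Module.finrank ℚ K := by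
  rw [Ideal.absNorm_span_singleton]
  have h1 : ((p : ℕ) : 𝓞 K) = algebraMap ℤ (𝓞 K) (p : ℤ) := by simp
  rw [h1, Algebra.norm_algebraMap, NumberField.RingOfIntegers.rank]
  simp [Int.natAbs_pow]

/-- **N3 (S, PROVED here; generic quadratic field).** A prime `𝔭 ∋ p` of a quadratic number field has norm `p`,
or else it IS `(p)` (`N𝔭 ∣ N((p)) = p²`, `N𝔭 ≠ 1`; if `N𝔭 = p²` then `(p) = 𝔭·J` with `N J = 1`). -/
theorem absNorm_eq_or_eq_span (K : Type) [Field K] [NumberField K]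
    (hK : Module.finrank ℚ K = 2) {p : ℕ} (hp : p.Prime) (𝔭 : HeightOneSpectrum (𝓞 K))
    (h𝔭 : ((p : ℕ) : 𝓞 K) ∈ 𝔭.asIdeal) :
    Ideal.absNorm 𝔭.asIdeal = p ∨ 𝔭.asIdeal = Ideal.span {((p : ℕ) : 𝓞 K)} := by
  have hle : Ideal.span {((p : ℕ) : 𝓞 K)} ≤ 𝔭.asIdeal := by
    rw [Ideal.span_singleton_le_iff_mem]; exact h𝔭
  have hdvd : Ideal.absNorm 𝔭.asIdeal ∣ p ^ 2 := by
    rw [← hK, ← absNorm_span_natCast K p]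
    exact Ideal.absNorm_dvd_absNorm_of_le hle
  obtain ⟨i, hi, hN⟩ := (Nat.dvd_prime_pow hp).mp hdvd
  have hN1 : (1 : ℕ) < Ideal.absNorm 𝔭.asIdeal := NumberField.HeightOneSpectrum.one_lt_absNorm 𝔭
  interval_cases i
  · rw [pow_zero] at hN; rw [hN] at hN1; exact absurd hN1 (lt_irrefl _)
  · left; rw [hN, pow_one]
  · right
    obtain ⟨J, hJ⟩ := Ideal.dvd_iff_le.mpr hle
    have h := congrArg Ideal.absNorm hJ
    rw [map_mul, absNorm_span_natCast K p, hK, hN] at h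
    have hp2 : p ^ 2 ≠ 0 := pow_ne_zero _ hp.ne_zero
    have hJ1 : Ideal.absNorm J = 1 := by
      have : p ^ 2 * Ideal.absNorm J = p ^ 2 * 1 := by rw [mul_one]; exact h.symm
      exact Nat.eq_of_mul_eq_mul_left (Nat.pos_of_ne_zero hp2) this
    rw [Ideal.absNorm_eq_one_iff] at hJ1
    rw [hJ, hJ1, Ideal.mul_top]

/-- **N4 (XS, PROVED).** `(5√5)² = 125`: `(5(2θ−1))² = 125` whenever `θ² = θ + 1`. -/
theorem sqrtFive_sq {R : Type*} [CommRing R] (θ : R) (hθ : θ * θ = θ + 1) :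
    (5 * (2 * θ - 1)) * (5 * (2 * θ - 1)) = (125 : R) := by
  linear_combination (100 : R) * hθ

/-- **N5 (S, PROVED here — the DEGREE-ONE COST of the golden norm form).** For a quadratic number field `K`
carrying `θ`, `θ² = θ+1`, and an automorphism `σ` with `σθ = 1 − θ`: if `p ≠ 5` is prime, `u, w`
coprime, `p ∣ Q = u² − 11uw − w²`, then EVERY prime `𝔭 ∋ p` of `𝓞_K` has `N𝔭 = p`.
Proof (ideal-level only): else `𝔭 = (p)` (N3), so `σ𝔭 = 𝔭` (`Ideal.map_span`, `map_natCast`);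
`Q = (u+β₂w)(u+β₃w) ∈ 𝔭` (tree `formTwo_mul_formThree`) ⇒ one form `∈ 𝔭` ⇒ (N2, `Ideal.mem_map_of_mem`)
both `∈ 𝔭` ⇒ `5(2θ−1) ∈ 𝔭` (tree `sqrtFive_mem_sup`, from `au + bw = 1`) ⇒ `125 ∈ 𝔭` (N4), `p ∈ 𝔭`,
`Nat.Coprime p 125` ⇒ `1 ∈ 𝔭`, contradicting `𝔭.isPrime.ne_top`. -/
theorem degOneCost_golden (K : Type) [Field K] [NumberField K] (hK : Module.finrank ℚ K = 2)
    (σ : K ≃+* K) (θ : 𝓞 K) (hθ : θ * θ = θ + 1)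
    (hσ : NumberField.RingOfIntegers.mapRingEquiv σ θ = 1 - θ) :
    DegOneCost K 11 (-1) 5 := by
  intro p hp hp5 u w huw hpQ hQ 𝔭 h𝔭
  rcases absNorm_eq_or_eq_span K hK hp 𝔭 h𝔭 with h | h
  · exact h
  · exfalso
    set τ := NumberField.RingOfIntegers.mapRingEquiv σ with hτ
    -- names for the forms
    set x₂ : 𝓞 K := (u : 𝓞 K) + (-3 - 5 * θ) * w with hx₂
    set x₃ : 𝓞 K := (u : 𝓞 K) + (-8 + 5 * θ) * w with hx₃
    have hτ₂ : τ x₂ = x₃ := by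
      simp only [hx₂, hx₃, map_add, map_sub, map_mul, map_neg, map_intCast, map_ofNat, hσ]; ring
    have hτ₃ : τ x₃ = x₂ := by
      simp only [hx₂, hx₃, map_add, map_mul, map_neg, map_intCast, map_ofNat, hσ]; ring
    -- σ fixes 𝔭 = (p)
    have hmap : Ideal.map τ 𝔭.asIdeal = 𝔭.asIdeal := by
      rw [h, Ideal.map_span, Set.image_singleton, map_natCast]
    -- Q ∈ 𝔭, Q = x₂ x₃
    have hQmem : x₂ * x₃ ∈ 𝔭.asIdeal := by
      have hprod : x₂ * x₃ = ((u ^ 2 - 11 * u * w - w ^ 2 : ℤ) : 𝓞 K) := by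
        have := Summit.ABC.ABC.Theorems.GoldenFromNFPencil.formTwo_mul_formThree θ (u : 𝓞 K) (w : 𝓞 K) hθ
        try simp only [one_mul] at this
        rw [hx₂, hx₃, this]; push_cast; ring
      obtain ⟨m, hm⟩ := hpQ
      have hm' : ((u ^ 2 - 11 * u * w - w ^ 2 : ℤ) : 𝓞 K) = ((p : ℕ) : 𝓞 K) * (m : 𝓞 K) := by
        have : u ^ 2 - 11 * u * w - w ^ 2 = (p : ℤ) * m := by
          have := hm; unfold normForm at this; linear_combination this
        rw [this]; push_cast; ring
      rw [hprod, hm']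
      exact Ideal.mul_mem_right _ _ h𝔭
    -- both forms lie in 𝔭
    have hboth : x₂ ∈ 𝔭.asIdeal ∧ x₃ ∈ 𝔭.asIdeal := by
      rcases 𝔭.isPrime.mem_or_mem hQmem with h2 | h3
      · refine ⟨h2, ?_⟩
        have := Ideal.mem_map_of_mem τ h2
        rwa [hmap, hτ₂] at this
      · refine ⟨?_, h3⟩
        have := Ideal.mem_map_of_mem τ h3
        rwa [hmap, hτ₃] at this
    -- hence 5√5 ∈ 𝔭 and 125 ∈ 𝔭
    obtain ⟨a, b, hab⟩ := huw
    have hab' : (a : 𝓞 K) * (u : 𝓞 K) + (b : 𝓞 K) * (w : 𝓞 K) = 1 := by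
      rw [← Int.cast_mul, ← Int.cast_mul, ← Int.cast_add, hab, Int.cast_one]
    have hc : (5 * (2 * θ - 1) : 𝓞 K) ∈ Ideal.span {x₂} ⊔ Ideal.span {x₃} := by
      have := Summit.ABC.ABC.Theorems.GoldenFromNFPencil.sqrtFive_mem_sup θ (u : 𝓞 K) (w : 𝓞 K)
        (-3 - 5 * θ) (-8 + 5 * θ) (a : 𝓞 K) (b : 𝓞 K) rfl rfl hab'
      simpa only [hx₂, hx₃, one_mul] using this
    have hc𝔭 : (5 * (2 * θ - 1) : 𝓞 K) ∈ 𝔭.asIdeal := by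
      have hsup : Ideal.span {x₂} ⊔ Ideal.span {x₃} ≤ 𝔭.asIdeal := by
        rw [sup_le_iff, Ideal.span_singleton_le_iff_mem, Ideal.span_singleton_le_iff_mem]
        exact hboth
      exact hsup hc
    have h125 : ((125 : ℕ) : 𝓞 K) ∈ 𝔭.asIdeal := by
      have hsq : (5 * (2 * θ - 1)) * (5 * (2 * θ - 1)) = ((125 : ℕ) : 𝓞 K) := by
        push_cast; linear_combination (100 : 𝓞 K) * hθ
      rw [← hsq]; exact Ideal.mul_mem_left _ _ hc𝔭
    -- gcd(p, 125) = 1 ∈ 𝔭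
    have hcop : Nat.Coprime p 125 := by
      have h5 : ¬ p ∣ 5 := hp5
      have : Nat.Coprime p 5 := (Nat.coprime_primes hp Nat.prime_five).mpr (fun h => h5 (h ▸ dvd_rfl))
      simpa using this.pow_right 3
    have h1 : (1 : 𝓞 K) ∈ 𝔭.asIdeal := by
      have hz : IsCoprime (p : ℤ) (125 : ℤ) := by exact_mod_cast Nat.Coprime.isCoprime hcop
      obtain ⟨c, d, hcd⟩ := hz
      have : (c : 𝓞 K) * ((p : ℕ) : 𝓞 K) + (d : 𝓞 K) * ((125 : ℕ) : 𝓞 K) = 1 := by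
        have := congrArg (fun z : ℤ => (z : 𝓞 K)) hcd
        push_cast at this ⊢; linear_combination this
      rw [← this]
      exact Ideal.add_mem _ (Ideal.mul_mem_left _ _ h𝔭) (Ideal.mul_mem_left _ _ h125)
    exact 𝔭.isPrime.ne_top ((Ideal.eq_top_iff_one _).mpr h1)

/-! ## §2 The fine non-archimedean half and the assembly (g5 H8/H11 with `rad(F)¹`) -/

/-- **H8f `fUpper_fine` (S+ given g6-H2' `memberBound`, g5 R1 `exists_prime_over`, R2
`padicValInt_le_ord`, H7 `ord_member`, and `DegOneCost`).**  `log|F| ≤ C₀ + C₁·T(u,w)·rad(F)`: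
`log|F| = Σ_{p∣F} v_p(F) log p`; per `p ∣ F` pick `𝔭 ∋ p` (R1); `v_p(F) log p ≤ ord_𝔭(F) log N𝔭 =
(ord_𝔭 x + ord_𝔭 x̄) log N𝔭 ≤ 2 ord_𝔭(n) log N𝔭 + 2T·N𝔭/log N𝔭` (R2, H7, memberBound at `α₀ = β, s−β`);
for `p ∤ N₀`: `N𝔭 = p` (DegOneCost) so the cost is `2T·p/log p`; for the finitely many `p ∣ N₀`:
`N𝔭 ≤ p^{[K:ℚ]} ≤ N₀^{[K:ℚ]}` (g5 R3 `place_cost`), a constant; `Σ_{p∣F} p/log p ≤ rad(F)/log 2`. -/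
theorem fUpper_fine (K : Type) [Field K] [NumberField K] (hP : NFPlaceBound K) (β : 𝓞 K)
    (s n : ℤ) (hβ : β * β = (s : 𝓞 K) * β - (n : 𝓞 K)) (hn : n ≠ 0) (N₀ : ℕ) (hN₀ : N₀ ≠ 0)
    (hdeg : DegOneCost K s n N₀) :
    ∃ A C C₀ C₁ : ℝ, 0 ≤ A ∧ 1 ≤ C ∧ 0 ≤ C₁ ∧ ∀ u w : ℤ, IsCoprime u w →
      u * w * normForm s n u w ≠ 0 →
      Real.log |((normForm s n u w : ℤ) : ℝ)| ≤
        C₀ + C₁ * memberT A C u w * (((radical (normForm s n u w)).natAbs : ℕ) : ℝ) := by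
  sorry

/-- **g5-H5 `fNotSmall` (S; OPEN in g5, signature ported VERBATIM so that the composition below
type-checks — prove it once, for either namespace).** Archimedean half: `2 log H ≤ log|F| + 2T`. -/
theorem fNotSmall (K : Type) [Field K] [NumberField K] (hP : NFPlaceBound K) (β : 𝓞 K) (s n : ℤ)
    (hβ : β * β = (s : 𝓞 K) * β - (n : 𝓞 K)) (hn : n ≠ 0) :
    ∃ A C : ℝ, 0 ≤ A ∧ 1 ≤ C ∧ ∀ u w : ℤ, u ≠ 0 → w ≠ 0 → normForm s n u w ≠ 0 →
      2 * Real.log (max (|(u : ℝ)|) (|(w : ℝ)|)) ≤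
        Real.log |((normForm s n u w : ℤ) : ℝ)| + 2 * memberT A C u w := by
  sorry

/-- **H11r `normFormSide_one_of_bounds` (S, NEW CUT — `K`-FREE real analysis).** From the two halves
(any constants) to `NormFormSide 1 s n`: with `y = log H`, `T_i ≤ T := memberT (max A₁ A₂) (max C₁ C₂)`
(monotone: `A ≥ 0`, `C ≥ 1`, all logs `≥ 0`), `2y ≤ C₀ + (2 + C₁') T rad F` (`rad F ≥ 1`, k1 `one_le_radR`);
`T = A C^{ω(uw)} (∏_{p∣uw} log p) log(2y+3)`; absorption (tree, by name):
`exists_pow_card_primeFactors_le_mul_rpow`, `exists_prod_log_primeFactors_le_mul_rpow` with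
`∏_{p∣uw} p = rad(uw) ≤ rad(uwF) =: R` (k1 `natAbs_radical_cast`, `Nat.radical_eq_prod_primeFactors`);
then `y ≤ A' R^{η} rad(F) log max(e, 2y)`-shape and k1 `endgame_abstract` (PROVED, crux-dir monolith :156)
with `R_i := R`, `m_i := rad F ≤ R`. No number field in sight. -/
theorem normFormSide_one_of_bounds (s n : ℤ)
    (hlow : ∃ A C : ℝ, 0 ≤ A ∧ 1 ≤ C ∧ ∀ u w : ℤ, u ≠ 0 → w ≠ 0 → normForm s n u w ≠ 0 →
      2 * Real.log (max (|(u : ℝ)|) (|(w : ℝ)|)) ≤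
        Real.log |((normForm s n u w : ℤ) : ℝ)| + 2 * memberT A C u w)
    (hup : ∃ A C C₀ C₁ : ℝ, 0 ≤ A ∧ 1 ≤ C ∧ 0 ≤ C₁ ∧ ∀ u w : ℤ, IsCoprime u w →
      u * w * normForm s n u w ≠ 0 →
      Real.log |((normForm s n u w : ℤ) : ℝ)| ≤
        C₀ + C₁ * memberT A C u w * (((radical (normForm s n u w)).natAbs : ℕ) : ℝ)) :
    NormFormSide 1 s n := by
  sorry

/-- **H11f `normFormSide_one` (PROVED composition of g5-H5, H8f, H11r).** -/
theorem normFormSide_one (K : Type) [Field K] [NumberField K] (hP : NFPlaceBound K) (β : 𝓞 K)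
    (s n : ℤ) (hβ : β * β = (s : 𝓞 K) * β - (n : 𝓞 K)) (hn : n ≠ 0) (N₀ : ℕ) (hN₀ : N₀ ≠ 0)
    (hdeg : DegOneCost K s n N₀) : NormFormSide 1 s n :=
  normFormSide_one_of_bounds s n (fNotSmall K hP β s n hβ hn) (fUpper_fine K hP β s n hβ hn N₀ hN₀ hdeg)

/-- Golden numerology (g5, PROVED there): `β = 3 + 5θ` has `β² = 11β − (−1)`. -/
theorem golden_beta_sq {R : Type*} [CommRing R] (θ : R) (hθ : θ * θ = θ + 1) :
    (3 + 5 * θ) * (3 + 5 * θ) = (11 : R) * (3 + 5 * θ) - (-1 : R) := by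
  linear_combination (25 : R) * hθ

/-- The golden norm form is `Q` (g5, PROVED). -/
theorem normForm_golden (u w : ℤ) : normForm 11 (-1) u w = u ^ 2 - 11 * u * w - w ^ 2 := by
  unfold normForm; ring

/-- **G `qSideRad_of_normFormSide_one` (XS).** `NormFormSide 1 11 (−1)` is `QSideRad` (rewrite by
`normForm_golden`, `pow_one`). -/
theorem qSideRad_of_normFormSide_one (h : NormFormSide 1 11 (-1)) : QSideRad := by
  intro δ hδ
  obtain ⟨κ, hκ⟩ := h δ hδ
  refine ⟨κ, fun u w huw h0 => ?_⟩
  have h0' : u * w * normForm 11 (-1) u w ≠ 0 := by rwa [normForm_golden]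
  have := hκ u w huw h0'
  simpa only [normForm_golden, pow_one] using this

/-- **G' `qSideRad_golden` (S−, instantiation — PROVED here modulo H11f).**  At `K = QuadraticAlgebra ℚ 1 1` (`Fact` from
`GoldenField.golden_fact`, `NumberField` from `GoldenField.numberField`, `finrank = 2` from
`GoldenField.finrank_eq_two`), `σ = starRingAut`, `θ = ⟨ω, _⟩` (N1, `GoldenFromNFPencil.theta_mul_theta`),
`β = 3 + 5θ` (`golden_beta_sq`): N5 gives `DegOneCost K 11 (−1) 5`, H11f gives `NormFormSide 1 11 (−1)`. -/
theorem qSideRad_golden (hP : ∀ (K : Type) [Field K] [NumberField K], NFPlaceBound K) :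
    QSideRad := by
  haveI hfact : Fact (∀ r : ℚ, r ^ 2 ≠ (1 : ℚ) + 1 * r) :=
    ⟨Summit.ABC.ABC.Theorems.GoldenField.golden_fact⟩
  haveI : NumberField (QuadraticAlgebra ℚ (1 : ℚ) 1) :=
    Summit.ABC.ABC.Theorems.GoldenField.numberField
  obtain ⟨θ, hθdef⟩ : ∃ θ : 𝓞 (QuadraticAlgebra ℚ (1 : ℚ) 1),
      θ = ⟨QuadraticAlgebra.omega, Summit.ABC.ABC.Theorems.GoldenField.isIntegral_omega⟩ := ⟨_, rfl⟩
  have hθ : θ * θ = θ + 1 := by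
    rw [hθdef]; exact Summit.ABC.ABC.Theorems.GoldenFromNFPencil.theta_mul_theta
  have hσ : NumberField.RingOfIntegers.mapRingEquiv
      (starRingAut : QuadraticAlgebra ℚ (1 : ℚ) 1 ≃+* QuadraticAlgebra ℚ (1 : ℚ) 1) θ = 1 - θ := by
    rw [hθdef]; exact sigma_theta
  have hβ : (3 + 5 * θ) * (3 + 5 * θ) =
      ((11 : ℤ) : 𝓞 (QuadraticAlgebra ℚ (1 : ℚ) 1)) * (3 + 5 * θ) -
        ((-1 : ℤ) : 𝓞 (QuadraticAlgebra ℚ (1 : ℚ) 1)) := by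
    push_cast; exact golden_beta_sq θ hθ
  have hfin : Module.finrank ℚ (QuadraticAlgebra ℚ (1 : ℚ) 1) = 2 :=
    Summit.ABC.ABC.Theorems.GoldenField.finrank_eq_two
  have hdeg : DegOneCost (QuadraticAlgebra ℚ (1 : ℚ) 1) 11 (-1) 5 :=
    degOneCost_golden _ hfin _ θ hθ hσ
  exact qSideRad_of_normFormSide_one
    (normFormSide_one (QuadraticAlgebra ℚ (1 : ℚ) 1) (hP _) (3 + 5 * θ) 11 (-1) hβ (by norm_num) 5
      (by norm_num) hdeg)

/-! ## §3 Payoff -/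

/-- `min a b ≤ a^s b^t` for `s + t = 1` (g5/g6, PROVED; ported). -/
theorem min_le_geom {a b s t : ℝ} (ha : 0 ≤ a) (hb : 0 ≤ b) (hs : 0 ≤ s) (ht : 0 ≤ t)
    (hst : s + t = 1) : min a b ≤ a ^ s * b ^ t := by
  have hm0 : 0 ≤ min a b := le_min ha hb
  have hsplit : min a b = (min a b) ^ s * (min a b) ^ t := by
    rw [← Real.rpow_add' hm0 (by rw [hst]; norm_num), hst, Real.rpow_one]
  rw [hsplit]
  exact mul_le_mul (Real.rpow_le_rpow hm0 (min_le_left a b) hs)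
    (Real.rpow_le_rpow hm0 (min_le_right a b) ht) (Real.rpow_nonneg hm0 t) (Real.rpow_nonneg ha s)

/-- **P1 `stub_of_uwHalf_qSideRad` (S−, real arithmetic — PROVED here).** `min(m, q) ≤ m^{2/3} q^{1/3} ≤ m^{2/3} q^{2/3}`
(`q ≥ 1`), so `UWHalf ∧ QSideRad ⇒` the registered stub (pattern: g5 `stub_of_uwHalf_qSideRadSq`,
g6 `cover_step`/`min_le_geom`). -/
theorem stub_of_uwHalf_qSideRad (h1 : UWHalf) (h2 : QSideRad) : StubConjugate := by
  intro ε hε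
  obtain ⟨κ₁, hκ₁⟩ := h1 ε hε
  obtain ⟨κ₂, hκ₂⟩ := h2 ε hε
  refine ⟨max (max κ₁ κ₂) 0, fun u w huw h0 => ?_⟩
  have hA := hκ₁ u w huw h0
  have hB := hκ₂ u w huw h0
  have hq01 : (((radical (u ^ 2 - 11 * u * w - w ^ 2)).natAbs : ℕ) : ℝ) = 0 ∨
      1 ≤ (((radical (u ^ 2 - 11 * u * w - w ^ 2)).natAbs : ℕ) : ℝ) := by
    rcases Nat.eq_zero_or_pos ((radical (u ^ 2 - 11 * u * w - w ^ 2)).natAbs) with h | h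
    · left; rw [h]; simp
    · right; exact_mod_cast h
  generalize hR : (((radical (u * w * (u ^ 2 - 11 * u * w - w ^ 2))).natAbs : ℕ) : ℝ) = R at *
  generalize hq : (((radical (u ^ 2 - 11 * u * w - w ^ 2)).natAbs : ℕ) : ℝ) = q at *
  generalize ha : (((radical u).natAbs : ℕ) : ℝ) = a at *
  generalize hb : (((radical w).natAbs : ℕ) : ℝ) = b at *
  generalize hL : Real.log (max (|(u : ℝ)|) (|(w : ℝ)|)) = L at *
  have hR0 : 0 ≤ R := by rw [← hR]; exact Nat.cast_nonneg _
  have hq0 : 0 ≤ q := by rw [← hq]; exact Nat.cast_nonneg _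
  have ha0 : 0 ≤ a := by rw [← ha]; exact Nat.cast_nonneg _
  have hb0 : 0 ≤ b := by rw [← hb]; exact Nat.cast_nonneg _
  have hm0 : 0 ≤ min a b := le_min ha0 hb0
  have hRe : 0 ≤ R ^ (ε : ℝ) := Real.rpow_nonneg hR0 _
  set κ : ℝ := max (max κ₁ κ₂) 0 with hκ
  have hκ0 : 0 ≤ κ := le_max_right _ _
  have hκR : 0 ≤ κ * R ^ (ε : ℝ) := mul_nonneg hκ0 hRe
  have hA' : L ≤ κ * R ^ (ε : ℝ) * min a b :=
    hA.trans (mul_le_mul_of_nonneg_right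
      (mul_le_mul_of_nonneg_right ((le_max_left κ₁ κ₂).trans (le_max_left (max κ₁ κ₂) 0)) hRe) hm0)
  have hB' : L ≤ κ * R ^ (ε : ℝ) * q :=
    hB.trans (mul_le_mul_of_nonneg_right
      (mul_le_mul_of_nonneg_right ((le_max_right κ₁ κ₂).trans (le_max_left (max κ₁ κ₂) 0)) hRe) hq0)
  have hmin : L ≤ κ * R ^ (ε : ℝ) * min (min a b) q := by
    rcases le_total (min a b) q with h | h
    · rw [min_eq_left h]; exact hA'
    · rw [min_eq_right h]; exact hB'
  have hgeom : min (min a b) q ≤ (min a b) ^ (2 / 3 : ℝ) * q ^ (1 / 3 : ℝ) :=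
    min_le_geom hm0 hq0 (by norm_num) (by norm_num) (by norm_num)
  have hq13 : q ^ (1 / 3 : ℝ) ≤ q ^ (2 / 3 : ℝ) := by
    rcases hq01 with h | h
    · rw [h, Real.zero_rpow (by norm_num), Real.zero_rpow (by norm_num)]
    · exact Real.rpow_le_rpow_of_exponent_le h (by norm_num)
  have hm23 : 0 ≤ (min a b) ^ (2 / 3 : ℝ) := Real.rpow_nonneg hm0 _
  calc L ≤ κ * R ^ (ε : ℝ) * min (min a b) q := hmin
    _ ≤ κ * R ^ (ε : ℝ) * ((min a b) ^ (2 / 3 : ℝ) * q ^ (1 / 3 : ℝ)) :=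
        mul_le_mul_of_nonneg_left hgeom hκR
    _ ≤ κ * R ^ (ε : ℝ) * ((min a b) ^ (2 / 3 : ℝ) * q ^ (2 / 3 : ℝ)) :=
        mul_le_mul_of_nonneg_left (mul_le_mul_of_nonneg_left hq13 hm23) hκR
    _ = κ * R ^ (ε : ℝ) * (q ^ (2 / 3 : ℝ) * (min a b) ^ (2 / 3 : ℝ)) := by ring

/-- Composition (kernel-checked modulo the `sorry`s above): the stub from the ℚ-engine output and
the number-field place bounds. (`UWHalf` := crux-dir `cuspMinRadBound_holds`; `hP` :=
g5 `nfPlaceBound_of_matveev_yu hM hY`.) -/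
theorem stub_of_uwHalf_nfPlaceBound (h0 : UWHalf)
    (hP : ∀ (K : Type) [Field K] [NumberField K], NFPlaceBound K) : StubConjugate :=
  stub_of_uwHalf_qSideRad h0 (qSideRad_golden hP)

end Summit.ABC.ABC.Cruxes.GoldenCuspShadow.SideaK2G7
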